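import Summits.ABC.ABC.Theses.IneffectiveSubspace

/-!
# `UniformSadicTowerFour` (stmt-ABC-14937), line `flat-steep-split`: reductions of the stub `stub_heavyPlaces`

The registered stub `stub_heavyPlaces` of the line is the crux on the NEAR-`S`-UNIT regime: for every budget
`K`, every `θ > 0` and `ε > 0` a constant `C` with `c < C · M_S(abc)^(1+ε)` for every NON-EMPTY set `S` of at
most `K` primes and every abc triple in which every `p ∈ S` is θ-HEAVY, `c^θ ≤ p^{v_p(abc)}`
(`M_S(N) = (∏_{p∈S} p) · ∏_{p ∣ N, p ∉ S} p^⌈v_p(N)/4⌉`, the mixed radical).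

This file proves, sorry-free, that two of its dials are IDLE:

* `card_mul_lt_three` — if every prime of `S` is θ-heavy for an abc triple then `θ · |S| < 3`
  (the heavy blocks are pairwise coprime, divide `abc`, and `abc < c³`); hence the budget `K` is idle:
  the statement at the single budget `K₀ = ⌈3/θ⌉₊` is the statement for all `K`;
* `blockLt_of_one_lt` — for `θ > 1` NO prime is θ-heavy (`p^{v_p(abc)} ≤ c`, the block sits inside one
  of the pairwise coprime `a, b, c`), so the range `θ > 1` of the stub is vacuous;

and packages them as the equivalence `heavyPlaces_iff_heavyCore` between the registered stub and its CORE
form `θ ∈ (0,1]`, no budget: `∀ θ ∈ (0,1], ∀ ε > 0 ∃ C ∀ S ≠ ∅ primes ∀ abc triples, (S heavy) → c < C·M_S^(1+ε)`.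
So after the flat/steep split the `K → ∞` direction of the crux has evaporated: the only uniformity left
in the heavy half is over WHICH (fewer than `3/θ`) heavy primes are discounted, with an `S`-free constant.
The boundary `θ = 1` is exactly the corner `c = p^k ∈ S` (uniform `PrimePowerRadical` in `rad₄`-form).

Also recorded: `flatFace_iff_quarter` — in the flat stub the dial `θ ≤ 1/4` is idle too (flatness is
monotone in `θ`), so `stub_flatFace` is ONE statement: abc with `rad₄` on `c^{1/4}`-powersmooth triples.
-/

-- `Summit.<Summit>.<Problem>` is the mandated summit-side namespace (CONVENTIONS §2); for the
-- single-conjunct summit `ABC` the two coincide, so the duplicate `ABC.ABC` is deliberate.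
set_option linter.dupNamespace false

namespace Summit.ABC.ABC.Theorems.UniformSadicTowerFour.HeavyPlaces

open Literature.NumberTheory.DiophantineGeometry (IsABCTriple)
open scoped BigOperators

/-! ## Blocks of an abc triple -/

/-- For an abc triple and a prime `p`, the full block `p^{v_p(abc)}` sits inside ONE of the pairwise
coprime numbers `a, b, c`; in particular `p^{v_p(abc)} ≤ c`. [folklore] -/
theorem block_le {a b c : ℕ} (h : IsABCTriple a b c) {p : ℕ} (hp : p.Prime) :
    p ^ (a * b * c).factorization p ≤ c := by
  obtain ⟨ha, hb, hsum, hcop⟩ := h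
  have hc : 0 < c := by omega
  have hfac : (a * b * c).factorization p =
      a.factorization p + b.factorization p + c.factorization p := by
    rw [Nat.factorization_mul (by positivity) hc.ne', Nat.factorization_mul ha.ne' hb.ne']
    rfl
  by_cases hpa : p ∣ a
  · have hpb : ¬ p ∣ b := fun hpb => hp.one_lt.ne' (Nat.eq_one_of_dvd_coprimes hcop hpa hpb)
    have hpc : ¬ p ∣ c := fun hpc => hpb ((Nat.dvd_add_right hpa).mp (hsum ▸ hpc))
    rw [hfac, Nat.factorization_eq_zero_of_not_dvd hpb, Nat.factorization_eq_zero_of_not_dvd hpc,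
      add_zero, add_zero]
    exact (Nat.ordProj_le p ha.ne').trans (by omega)
  · by_cases hpb : p ∣ b
    · have hpc : ¬ p ∣ c := fun hpc => hpa ((Nat.dvd_add_left hpb).mp (hsum ▸ hpc))
      rw [hfac, Nat.factorization_eq_zero_of_not_dvd hpa, Nat.factorization_eq_zero_of_not_dvd hpc,
        zero_add, add_zero]
      exact (Nat.ordProj_le p hb.ne').trans (by omega)
    · rw [hfac, Nat.factorization_eq_zero_of_not_dvd hpa, Nat.factorization_eq_zero_of_not_dvd hpb,
        zero_add, zero_add]
      exact Nat.ordProj_le p hc.ne'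

/-- A product of full prime-power blocks of `N` over a set of distinct primes divides `N`. [folklore] -/
theorem prod_block_dvd (N : ℕ) (S : Finset ℕ) (hS : ∀ p ∈ S, p.Prime) :
    (∏ p ∈ S, p ^ N.factorization p) ∣ N := by
  classical
  induction S using Finset.induction_on with
  | empty => simp
  | insert p S hpS ih =>
    rw [Finset.prod_insert hpS]
    have hp : p.Prime := hS p (Finset.mem_insert_self p S)
    have hS' : ∀ q ∈ S, q.Prime := fun q hq => hS q (Finset.mem_insert_of_mem hq)
    have hcop : Nat.Coprime (p ^ N.factorization p) (∏ q ∈ S, q ^ N.factorization q) := by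
      refine Nat.Coprime.prod_right fun q hq => ?_
      have hne : p ≠ q := fun h => hpS (h ▸ hq)
      exact ((Nat.coprime_primes hp (hS' q hq)).mpr hne).pow _ _
    exact hcop.mul_dvd_of_dvd_of_dvd (Nat.ordProj_dvd N p) (ih hS')

/-- `abc < c³` for an abc triple (`a, b < c`). [folklore] -/
theorem abc_lt_cube {a b c : ℕ} (h : IsABCTriple a b c) : a * b * c < c ^ 3 := by
  obtain ⟨ha, hb, hsum, _⟩ := h
  have hac : a < c := by omega
  have hbc : b < c := by omega
  have hc : 0 < c := by omega
  have hab : a * b < c * c := Nat.mul_lt_mul'' hac hbc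
  calc a * b * c < c * c * c := (Nat.mul_lt_mul_right hc).mpr hab
    _ = c ^ 3 := by ring

/-! ## The budget dial is idle: fewer than `3/θ` heavy primes -/

/-- **Card bound in the heavy regime.** If every prime of `S` is θ-heavy for the abc triple
(`c^θ ≤ p^{v_p(abc)}`), then `θ · |S| < 3`: the heavy blocks multiply to at least `c^{θ|S|}`, and
their product divides `abc < c³`. [folklore] -/
theorem card_mul_lt_three {a b c : ℕ} (h : IsABCTriple a b c) {θ : ℝ}
    {S : Finset ℕ} (hS : ∀ p ∈ S, p.Prime)
    (hheavy : ∀ p ∈ S, (c : ℝ) ^ θ ≤ ((p ^ (a * b * c).factorization p : ℕ) : ℝ)) :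
    θ * S.card < 3 := by
  have h' := h
  obtain ⟨ha, hb, hsum, hcop⟩ := h
  have hc : 0 < c := by omega
  set N := a * b * c with hN
  have hN0 : N ≠ 0 := Nat.mul_ne_zero (Nat.mul_ne_zero ha.ne' hb.ne') hc.ne'
  have hc2 : (2 : ℝ) ≤ c := by exact_mod_cast (show 2 ≤ c by omega)
  have hc1 : (1 : ℝ) < c := by linarith
  have h1 : (c : ℝ) ^ (θ * S.card) ≤ ((∏ p ∈ S, p ^ N.factorization p : ℕ) : ℝ) := by
    rw [Real.rpow_mul (by positivity), Real.rpow_natCast, ← Finset.prod_const, Nat.cast_prod]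
    exact Finset.prod_le_prod (fun p _ => by positivity) fun p hp => hheavy p hp
  have h2 : ((∏ p ∈ S, p ^ N.factorization p : ℕ) : ℝ) ≤ N := by
    exact_mod_cast Nat.le_of_dvd (Nat.pos_of_ne_zero hN0) (prod_block_dvd N S hS)
  have h3 : (N : ℝ) < (c : ℝ) ^ ((3 : ℕ) : ℝ) := by
    rw [Real.rpow_natCast]
    exact_mod_cast abc_lt_cube h'
  have h4 : (c : ℝ) ^ (θ * S.card) < (c : ℝ) ^ ((3 : ℕ) : ℝ) := (h1.trans h2).trans_lt h3
  have := (Real.rpow_lt_rpow_left_iff hc1).mp h4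
  exact_mod_cast this

/-- Consequently a non-empty heavy `S` forces `|S| < 3/θ`, i.e. `|S| ≤ ⌈3/θ⌉₊`: any budget
`K ≥ ⌈3/θ⌉₊` is automatic. [folklore] -/
theorem card_le_ceil {a b c : ℕ} (h : IsABCTriple a b c) {θ : ℝ} (hθ : 0 < θ)
    {S : Finset ℕ} (hS : ∀ p ∈ S, p.Prime)
    (hheavy : ∀ p ∈ S, (c : ℝ) ^ θ ≤ ((p ^ (a * b * c).factorization p : ℕ) : ℝ)) :
    S.card ≤ ⌈3 / θ⌉₊ := by
  have h3 := card_mul_lt_three h hS hheavy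
  have hlt : (S.card : ℝ) < 3 / θ := by
    rw [lt_div_iff₀ hθ]; linarith [mul_comm θ (S.card : ℝ)]
  exact Nat.cast_le.mp ((hlt.le.trans (Nat.le_ceil _)).trans (by norm_cast))

/-! ## The range `θ > 1` is vacuous -/

/-- For `θ > 1` no prime is θ-heavy: every block satisfies `p^{v_p(abc)} ≤ c < c^θ`. [folklore] -/
theorem blockLt_of_one_lt {a b c : ℕ} (h : IsABCTriple a b c) {θ : ℝ} (hθ : 1 < θ) {p : ℕ}
    (hp : p.Prime) : ((p ^ (a * b * c).factorization p : ℕ) : ℝ) < (c : ℝ) ^ θ := by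
  have hc2 : (2 : ℝ) ≤ c := by
    obtain ⟨ha, hb, hsum, _⟩ := h
    exact_mod_cast (show 2 ≤ c by omega)
  have hle : ((p ^ (a * b * c).factorization p : ℕ) : ℝ) ≤ c := by exact_mod_cast block_le h hp
  refine hle.trans_lt ?_
  calc (c : ℝ) = (c : ℝ) ^ (1 : ℝ) := (Real.rpow_one _).symm
    _ < (c : ℝ) ^ θ := Real.rpow_lt_rpow_of_exponent_lt (by linarith) hθ

/-! ## The registered stub reduced to its core form -/

/-- **Reduction (registered stub `stub_heavyPlaces_of_heavyCore`).** The CORE form of the heavy-places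
statement — `θ ∈ (0, 1]`, NO budget on `|S|` — implies the registered stub `stub_heavyPlaces` verbatim
(for `θ > 1` the hypothesis is vacuous by `blockLt_of_one_lt`; for `θ ≤ 1` the budget is simply dropped).
[folklore] -/
theorem stub_heavyPlaces_of_heavyCore
    (h : ∀ θ : ℝ, 0 < θ → θ ≤ 1 → ∀ ε : ℝ, 0 < ε → ∃ C : ℝ, 0 < C ∧ ∀ S : Finset ℕ, S.Nonempty →
      (∀ p ∈ S, Nat.Prime p) → ∀ a b c : ℕ, IsABCTriple a b c →
      (∀ p ∈ S, (c : ℝ) ^ θ ≤ ((p ^ (a * b * c).factorization p : ℕ) : ℝ)) →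
      (c : ℝ) < C * ((((∏ p ∈ S, p) *
        ∏ p ∈ (a * b * c).primeFactors \ S, p ^ (((a * b * c).factorization p + 3) / 4) : ℕ) : ℝ)) ^
          (1 + ε)) :
    ∀ K : ℕ, ∀ θ : ℝ, 0 < θ → ∀ ε : ℝ, 0 < ε → ∃ C : ℝ, 0 < C ∧ ∀ S : Finset ℕ, S.Nonempty →
      S.card ≤ K → (∀ p ∈ S, Nat.Prime p) → ∀ a b c : ℕ, IsABCTriple a b c →
      (∀ p ∈ S, (c : ℝ) ^ θ ≤ ((p ^ (a * b * c).factorization p : ℕ) : ℝ)) →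
      (c : ℝ) < C * ((((∏ p ∈ S, p) *
        ∏ p ∈ (a * b * c).primeFactors \ S, p ^ (((a * b * c).factorization p + 3) / 4) : ℕ) : ℝ)) ^
          (1 + ε) := by
  intro K θ hθ ε hε
  by_cases hθ1 : θ ≤ 1
  · obtain ⟨C, hC, hcore⟩ := h θ hθ hθ1 ε hε
    exact ⟨C, hC, fun S hSne _ hS a b c habc hheavy => hcore S hSne hS a b c habc hheavy⟩
  · -- θ > 1: a non-empty heavy `S` does not exist
    refine ⟨1, one_pos, fun S hSne _ hS a b c habc hheavy => ?_⟩
    obtain ⟨p, hp⟩ := hSne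
    exact absurd (hheavy p hp) (not_le.mpr (blockLt_of_one_lt habc (not_le.mp hθ1) (hS p hp)))

/-- **Converse**: the registered stub implies its core form (budget `K₀ = ⌈3/θ⌉₊` suffices by
`card_le_ceil`). [folklore] -/
theorem heavyCore_of_heavyPlaces
    (h : ∀ K : ℕ, ∀ θ : ℝ, 0 < θ → ∀ ε : ℝ, 0 < ε → ∃ C : ℝ, 0 < C ∧ ∀ S : Finset ℕ, S.Nonempty →
      S.card ≤ K → (∀ p ∈ S, Nat.Prime p) → ∀ a b c : ℕ, IsABCTriple a b c →
      (∀ p ∈ S, (c : ℝ) ^ θ ≤ ((p ^ (a * b * c).factorization p : ℕ) : ℝ)) →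
      (c : ℝ) < C * ((((∏ p ∈ S, p) *
        ∏ p ∈ (a * b * c).primeFactors \ S, p ^ (((a * b * c).factorization p + 3) / 4) : ℕ) : ℝ)) ^
          (1 + ε)) :
    ∀ θ : ℝ, 0 < θ → θ ≤ 1 → ∀ ε : ℝ, 0 < ε → ∃ C : ℝ, 0 < C ∧ ∀ S : Finset ℕ, S.Nonempty →
      (∀ p ∈ S, Nat.Prime p) → ∀ a b c : ℕ, IsABCTriple a b c →
      (∀ p ∈ S, (c : ℝ) ^ θ ≤ ((p ^ (a * b * c).factorization p : ℕ) : ℝ)) →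
      (c : ℝ) < C * ((((∏ p ∈ S, p) *
        ∏ p ∈ (a * b * c).primeFactors \ S, p ^ (((a * b * c).factorization p + 3) / 4) : ℕ) : ℝ)) ^
          (1 + ε) := by
  intro θ hθ _ ε hε
  obtain ⟨C, hC, hK⟩ := h ⌈3 / θ⌉₊ θ hθ ε hε
  exact ⟨C, hC, fun S hSne hS a b c habc hheavy =>
    hK S hSne (card_le_ceil habc hθ hS hheavy) hS a b c habc hheavy⟩

/-- **The budget and the range `θ > 1` are idle**: `stub_heavyPlaces` ⟺ its core form. [folklore] -/
theorem heavyPlaces_iff_heavyCore :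
    (∀ K : ℕ, ∀ θ : ℝ, 0 < θ → ∀ ε : ℝ, 0 < ε → ∃ C : ℝ, 0 < C ∧ ∀ S : Finset ℕ, S.Nonempty →
      S.card ≤ K → (∀ p ∈ S, Nat.Prime p) → ∀ a b c : ℕ, IsABCTriple a b c →
      (∀ p ∈ S, (c : ℝ) ^ θ ≤ ((p ^ (a * b * c).factorization p : ℕ) : ℝ)) →
      (c : ℝ) < C * ((((∏ p ∈ S, p) *
        ∏ p ∈ (a * b * c).primeFactors \ S, p ^ (((a * b * c).factorization p + 3) / 4) : ℕ) : ℝ)) ^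
          (1 + ε)) ↔
    (∀ θ : ℝ, 0 < θ → θ ≤ 1 → ∀ ε : ℝ, 0 < ε → ∃ C : ℝ, 0 < C ∧ ∀ S : Finset ℕ, S.Nonempty →
      (∀ p ∈ S, Nat.Prime p) → ∀ a b c : ℕ, IsABCTriple a b c →
      (∀ p ∈ S, (c : ℝ) ^ θ ≤ ((p ^ (a * b * c).factorization p : ℕ) : ℝ)) →
      (c : ℝ) < C * ((((∏ p ∈ S, p) *
        ∏ p ∈ (a * b * c).primeFactors \ S, p ^ (((a * b * c).factorization p + 3) / 4) : ℕ) : ℝ)) ^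
          (1 + ε)) :=
  ⟨heavyCore_of_heavyPlaces, stub_heavyPlaces_of_heavyCore⟩

/-! ## The flat stub: the dial `θ ≤ 1/4` is idle -/

/-- Flatness is monotone in `θ`, so `stub_flatFace` is equivalent to its single instance `θ = 1/4`:
abc with the 4-rounded radical on `c^{1/4}`-powersmooth triples. [folklore] -/
theorem flatFace_iff_quarter :
    (∀ θ : ℝ, 0 < θ → θ ≤ 1 / 4 → ∀ ε : ℝ, 0 < ε → ∃ C : ℝ, 0 < C ∧ ∀ a b c : ℕ, IsABCTriple a b c →
      (∀ p ∈ (a * b * c).primeFactors,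
        ((p ^ (a * b * c).factorization p : ℕ) : ℝ) < (c : ℝ) ^ θ) →
      (c : ℝ) < C * ((∏ p ∈ (a * b * c).primeFactors,
        p ^ (((a * b * c).factorization p + 3) / 4) : ℕ) : ℝ) ^ (1 + ε)) ↔
    (∀ ε : ℝ, 0 < ε → ∃ C : ℝ, 0 < C ∧ ∀ a b c : ℕ, IsABCTriple a b c →
      (∀ p ∈ (a * b * c).primeFactors,
        ((p ^ (a * b * c).factorization p : ℕ) : ℝ) < (c : ℝ) ^ (1 / 4 : ℝ)) →
      (c : ℝ) < C * ((∏ p ∈ (a * b * c).primeFactors,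
        p ^ (((a * b * c).factorization p + 3) / 4) : ℕ) : ℝ) ^ (1 + ε)) := by
  constructor
  · intro h ε hε
    exact h (1 / 4) (by norm_num) le_rfl ε hε
  · intro h θ _ hθ4 ε hε
    obtain ⟨C, hC, hq⟩ := h ε hε
    refine ⟨C, hC, fun a b c habc hflat => hq a b c habc fun p hp => (hflat p hp).trans_le ?_⟩
    have hc1 : (1 : ℝ) ≤ c := by
      obtain ⟨ha, hb, hsum, _⟩ := habc
      exact_mod_cast (show 1 ≤ c by omega)
    exact Real.rpow_le_rpow_of_exponent_le hc1 hθ4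

end Summit.ABC.ABC.Theorems.UniformSadicTowerFour.HeavyPlaces
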